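import Mathlib.FieldTheory.Finite.GaloisField
import Mathlib.LinearAlgebra.Matrix.ToLinearEquiv
import Mathlib.LinearAlgebra.Trace
import Literature.AlgebraicGeometry.Motives.FaltingsECIsogenyProofs
import Literature.NumberTheory.EllipticCurves.TateModuleFreeProofs
import Literature.NumberTheory.EllipticCurves.GaloisActionProofs
import HarnessLib

/-!
# Tate's isogeny theorem `E ~ E' ↔ #E(k) = #E'(k)`: the `ℓ`-adic assembly

D-0014 keeps `Literature/` sorry-free by stating cited results as named facts `def X : Prop`.
This sibling file of `Literature.AlgebraicGeometry.Motives.FaltingsEC` (and of its proof file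
`FaltingsECIsogenyProofs`) proves the conclusion of the named fact
`Literature.Hodge.isIsogenous_iff_card_point_eq W W'` — two elliptic curves over a finite field `k` are
isogenous over `k` iff `#E(k) = #E'(k)` (Tate 1966, §3 Thm. 1; Silverman, *AEC*, 2nd ed.,
Exercise 5.4, whose hint is the isogeny theorem III.7.7(a) = Tate's theorem) — **from** the two
inputs of the printed proof that the tree does not prove, entering as explicit hypotheses:

* `hT` — **Tate's theorem in Tate-module form** (Tate 1966, Main Theorem and Thm. 1; *AEC*
  Thm. III.7.7(a)): for a prime `ℓ ≠ char k`, `E ~ E'` iff there is a non-zero `ℤ_ℓ`-linear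
  `Γ_k`-equivariant map `T_ℓ E → T_ℓ E'`; the named fact
  `Literature.Hodge.isIsogenous_of_finite_iff_exists_tateModule_hom_ne_zero W W' ℓ` of `FaltingsEC` (the
  corrected reading of the deprecated `isIsogenous_iff_exists_tateModule_hom_ne_zero_of_finite`).
  Only its direction `←` is needed; `FaltingsECIsogenyProofs` reduces it further to Tate's Main
  Theorem `mem_span_range_tateModule_map_of_equivariant_of_finite W W' ℓ` (surjectivity of
  `Hom_k(E, E') ⊗ ℤ_ℓ → Hom_{Γ_k}(T_ℓ E, T_ℓ E')`) by
  `isIsogenous_iff_exists_tateModule_hom_ne_zero_of_finite_of_tate`, used below (the same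
  reduction stated against the corrected fact is
  `isIsogenous_of_finite_iff_exists_tateModule_hom_ne_zero_of_tate` of
  `FaltingsECIsogenyFiniteProofs`, not imported here).
* `htr, hdet` (and `htr', hdet'` for `E'`) — **trace and determinant of Frobenius on `T_ℓ E`**
  (*AEC* Thm. V.2.3.1, proof, and Remark V.2.6: `tr(φ_ℓ) = q + 1 - #E(k)`, `det(φ_ℓ) = q` for
  the `q`-power Frobenius `φ` and `ℓ ≠ char k`), spelled out verbatim: they are the bodies of the
  named facts `WeierstrassCurve.trace_galoisRepTate_frobenius W ℓ`,
  `WeierstrassCurve.det_galoisRepTate_frobenius W ℓ` of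
  `Literature.NumberTheory.EllipticCurves.FrobeniusTateModule` (proposed alongside; this file
  does not import it, so that it checks against the current tree, and feeding the named facts is
  a one-line `exact`). The Frobenius is any `σ ∈ Γ_k` with `σ x = x ^ q` on `k̄` (it exists,
  `exists_frobenius`, and is unique); on `E(k̄)` it *is* the `q`-power Frobenius endomorphism
  `(x, y) ↦ (x^q, y^q)` of *AEC* V.§2, so `W.galoisRepTate ℓ σ` is Silverman's `φ_ℓ`.

Everything else is proved here, on top of the tree's theorems `T_ℓ E ≅ ℤ_ℓ²` for `ℓ ≠ char k`
(`WeierstrassCurve.module_free_tateModule_holds`, `module_finite_tateModule_holds`,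
`finrank_tateModule_eq_two_holds`), finiteness of `E[ℓ^n]` (`finite_torsionPoints_holds`), the
equivariance of `T_ℓ φ` (`Literature.AlgebraicGeometry.Motives.tateModule_map_smul`) and its injectivity
(`Literature.AlgebraicGeometry.Motives.tateModule_map_injective`, `FaltingsECIsogenyProofs`):

* `Literature.AlgebraicGeometry.Motives.card_point_eq_of_isIsogenous_of` (**Exercise 5.4(a)**, needs only `htr, htr'`):
  isogenous curves have the same number of points;
* `Literature.AlgebraicGeometry.Motives.isIsogenous_of_card_point_eq_of` (**Exercise 5.4(b)**, needs `hT` and the four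
  trace/determinant statements);
* `Literature.AlgebraicGeometry.Motives.isIsogenous_iff_card_point_eq_of` (facts at one prime `ℓ ≠ char k`),
  `Literature.AlgebraicGeometry.Motives.isIsogenous_iff_card_point_eq_of_tate` (the same with Tate's Main Theorem
  `mem_span_range_tateModule_map_of_equivariant_of_finite W W' ℓ` in place of `hT`) and
  `Literature.AlgebraicGeometry.Motives.isIsogenous_iff_card_point_eq_of_forall` (facts at all primes; a prime `ℓ ∈ {2, 3}`
  with `ℓ ≠ char k` exists): the named fact `isIsogenous_iff_card_point_eq W W'` itself.
  `isIsogenous_iff_card_point_eq_holds` is **not** asserted: it is `…_of_forall` (or `…_of_tate`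
  at `ℓ ∈ {2, 3}`) once the remaining named facts are discharged.

## The argument

Fix `ℓ ≠ char k`, the Frobenius `τ`, and `ℤ_ℓ`-bases of the rank-`2` lattices `T_ℓ E`, `T_ℓ E'`;
let `A, A'` be the matrices of `τ`.

(→) For an isogeny `φ` over `k`, `g = T_ℓ φ : T_ℓ E → T_ℓ E'` is injective (finite kernel) and
commutes with `τ` (`tateModule_map_smul`). Its matrix `G` satisfies `G A = A' G` and `det G ≠ 0`
(an injective map has no kernel vector, `Matrix.exists_mulVec_eq_zero_iff`), so `tr A = tr A'`
(`tr (G A adj G) = det G · tr A`) and `q + 1 - #E(k) = q + 1 - #E'(k)` in `ℤ_ℓ`.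

(←) If `#E(k) = #E'(k)` then `A, A'` have the same trace `t` and determinant `d`, so by
Cayley–Hamilton `X = A' Y + Y A - t Y` satisfies `A' X = X A` for every `Y`; either some such `X`
is non-zero, or `A = A'` is scalar and `X = 1` works (`exists_ne_zero_matrix_fin_two_intertwiner`).
The linear map `f` of matrix `X` is non-zero and commutes with `τ`. It commutes with all of
`Γ_k`: given `σ` and `n`, the coordinates of the finitely many points of `E[ℓ^n] ∪ E'[ℓ^n]`
generate a finite extension of `k`, on which `σ` is a power `τ^m` of Frobenius (Mathlib
`FiniteField.bijective_frobeniusAlgEquivOfAlgebraic_pow`), so `σ = τ^m` on these points; and the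
`n`-th component of `f x` depends only on `x_n` (`TateModule.proj_map_eq_of_proj_eq`: if `x_n = 0`
then `x = ℓ^n x'`), whence `(f(σx))_n = (f(τ^m x))_n = τ^m (f x)_n = σ (f x)_n`. Tate's theorem
`hT` turns `f` into an isogeny.

Silverman's hint for (←) is the same route (III.7.7(a) after identifying the characteristic
polynomials of Frobenius through V.2.3.1); for (→) he argues with degrees
(`#E(𝔽_q) = deg(1 - φ)`), which the trace identity V.2.3.1 replaces here. Tate (1966, §3,
proof of Thm. 1) argues the same way: the characteristic polynomial of Frobenius determines the
`Γ_k`-module `V_ℓ` (semisimplicity), and `Hom_k(E, E') ⊗ ℚ_ℓ ≅ Hom_{Γ_k}(V_ℓ E, V_ℓ E')`.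

## References

* [Tate1966Endomorphisms] J. Tate, *Endomorphisms of abelian varieties over finite fields*,
  Invent. Math. 2 (1966), 134–144: Main Theorem, §3 Theorem 1 (not held; paywalled,
  doi:10.1007/bf01404549, acquisition requested).
* [SilvermanAEC2009] J. H. Silverman, *The Arithmetic of Elliptic Curves*, 2nd ed., GTM 106,
  Springer 2009 (held: `book:silverman2009-arithmetic-elliptic-curves-2nd-ed`): Exercise 5.4
  (PDF p. 139), Thm. III.7.7 (PDF p. 86), Prop. V.2.3, Thm. V.2.3.1 and its proof, Remark V.2.6
  (PDF pp. 129–131), III.§7 (Tate module, Thm. III.7.4), Cor. III.6.4.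
* J.-P. Serre, *Local Fields*, GTM 67, XIII.§1 (`Gal(k̄/k) ≅ ℤ̂`, Frobenius).

## Design

`noncomputable section`, `open scoped Classical` (the conventions of `GaloisAction`/`TateModule`,
so that `geomTorsion`, `•` and the named facts are literally those of the tree); universes `u`
(base field, curves, Tate modules) and `v` (auxiliary rings/groups). Generic material lives in
`namespace Literature` / `Literature.NumberTheory.EllipticCurves.TateModule`, point-level lemmas are deliberate dot-notation extensions in
`namespace WeierstrassCurve.geomPoints`, the assembly is in `namespace Literature.Hodge` next to the fact
it serves. This file adds theorems only (no definitions). Mathlib supplies the `2 × 2` algebra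
(`Matrix.trace_fin_two`, `Matrix.det_fin_two`, `Matrix.mul_adjugate`, `Matrix.trace_mul_cycle`,
`Matrix.exists_mulVec_eq_zero_iff`), `LinearMap.toMatrix`/`Matrix.toLin`,
`Module.finBasisOfFinrankEq`, and the finite-field Galois theory (`IntermediateField.adjoin`,
`AlgEquiv.restrictNormal`, the `IsGalois` instance for finite fields,
`FiniteField.bijective_frobeniusAlgEquivOfAlgebraic_pow`).
-/

noncomputable section

open scoped Classical
open scoped AddSubgroup

universe u v

namespace Literature.AlgebraicGeometry.Motives

/-! ## Generic `ℓ`-adic lemmas on Tate modules of abelian groups -/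

section TateModule
open Literature.NumberTheory.EllipticCurves (TateModule)
open Literature.NumberTheory.EllipticCurves.TateModule

variable {A : Type u} [AddCommGroup A] {B : Type v} [AddCommGroup B] {p : ℕ}

/-- **Shift.** An element of `T_p A` whose `n`-th component vanishes is `p^n` times the shifted
sequence `(a_{n+k})_k` (which is again compatible). [folklore] -/
theorem _root_.Literature.NumberTheory.EllipticCurves.TateModule.exists_nsmul_eq_of_proj_eq_zero {a : TateModule A p} {n : ℕ} (h : proj p n a = 0) :
    ∃ a' : TateModule A p, p ^ n • a' = a := by
  refine ⟨mk (fun k ↦ proj p (n + k) a) (fun k ↦ by rw [pow_smul_proj_add, h])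
    (fun k ↦ smul_proj_succ (n + k) a), TateModule.ext fun k ↦ ?_⟩
  rw [map_nsmul, proj_mk, Nat.add_comm, pow_smul_proj_add]

/-- **Locality of additive maps between Tate modules.** The `n`-th component of `f a` depends
only on the `n`-th component of `a`, for any additive `f : T_p A → T_p B`: if `a_n = b_n` then
`a - b = p^n c` and `(f (a - b))_n = p^n (f c)_n = 0`. [folklore] -/
theorem _root_.Literature.NumberTheory.EllipticCurves.TateModule.proj_map_eq_of_proj_eq (f : TateModule A p →+ TateModule B p) {a b : TateModule A p}
    {n : ℕ} (h : proj p n a = proj p n b) : proj p n (f a) = proj p n (f b) := by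
  have hab : proj p n (a - b) = 0 := by rw [map_sub (proj p n) a b, h, sub_self]
  obtain ⟨c, hc⟩ := exists_nsmul_eq_of_proj_eq_zero hab
  have hf : f a - f b = p ^ n • f c := by rw [← map_sub f a b, ← hc, map_nsmul]
  rw [← sub_eq_zero, ← map_sub (proj p n) (f a) (f b), hf, map_nsmul, pow_smul_proj]

end TateModule

/-! ## `2 × 2` matrices: Cayley–Hamilton, intertwiners, conjugation invariance of the trace -/

section Matrices

variable {R : Type v} [CommRing R]

/-- Cayley–Hamilton for `2 × 2` matrices: `A² - (tr A) A + (det A) 1 = 0`. [folklore] -/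
theorem matrix_fin_two_cayley_hamilton (A : Matrix (Fin 2) (Fin 2) R) :
    A * A - A.trace • A + A.det • (1 : Matrix (Fin 2) (Fin 2) R) = 0 := by
  ext i j
  fin_cases i <;> fin_cases j <;>
    simp [Matrix.mul_apply, Fin.sum_univ_two, Matrix.trace_fin_two, Matrix.det_fin_two] <;> ring

/-- If `A, A'` are `2 × 2` matrices with the same trace `t` and the same determinant, then for
every `Y` the matrix `X = A' Y + Y A - t Y` intertwines them: `A' X = X A` (both sides equal
`A' Y A - (det A) Y` by Cayley–Hamilton). [folklore] -/
theorem matrix_fin_two_mul_intertwiner {A A' : Matrix (Fin 2) (Fin 2) R} (ht : A'.trace = A.trace)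
    (hd : A'.det = A.det) (Y : Matrix (Fin 2) (Fin 2) R) :
    A' * (A' * Y + Y * A - A.trace • Y) = (A' * Y + Y * A - A.trace • Y) * A := by
  have hA := matrix_fin_two_cayley_hamilton A
  have hA' := matrix_fin_two_cayley_hamilton A'
  rw [ht, hd] at hA'
  have e1 : A * A = A.trace • A - A.det • 1 := by rw [← sub_eq_zero, ← hA]; abel
  have e2 : A' * A' = A.trace • A' - A.det • 1 := by rw [← sub_eq_zero, ← hA']; abel
  calc A' * (A' * Y + Y * A - A.trace • Y)
      = A' * A' * Y + A' * Y * A - A.trace • (A' * Y) := by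
        rw [mul_sub, mul_add, mul_assoc, mul_assoc, mul_smul_comm]
    _ = A' * Y * A - A.det • Y := by
        rw [e2, sub_mul, smul_mul_assoc, smul_mul_assoc, one_mul, mul_assoc]; abel
    _ = A' * Y * A + Y * (A * A) - A.trace • (Y * A) := by
        rw [e1, mul_sub, mul_smul_comm, mul_smul_comm, mul_one]; abel
    _ = (A' * Y + Y * A - A.trace • Y) * A := by
        rw [sub_mul, add_mul, mul_assoc Y A A, smul_mul_assoc]

/-- **Intertwiners exist.** Two `2 × 2` matrices over a nontrivial commutative ring with the same
trace and determinant admit a non-zero `X` with `A' X = X A`: either some `A' Y + Y A - t Y` is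
non-zero, or (taking `Y = 1, E₁₂, E₂₁`) `A' = t - A` and `A` is central, whence `A = A' ` is
scalar and `X = 1` works. (Over a field this is the statement that matrices with the same
characteristic polynomial of degree `2` share an eigenvalue.) [folklore] -/
theorem exists_ne_zero_matrix_fin_two_intertwiner [Nontrivial R] {A A' : Matrix (Fin 2) (Fin 2) R}
    (ht : A'.trace = A.trace) (hd : A'.det = A.det) :
    ∃ X : Matrix (Fin 2) (Fin 2) R, X ≠ 0 ∧ A' * X = X * A := by
  by_cases h : ∃ Y : Matrix (Fin 2) (Fin 2) R, A' * Y + Y * A - A.trace • Y ≠ 0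
  · obtain ⟨Y, hY⟩ := h
    exact ⟨_, hY, matrix_fin_two_mul_intertwiner ht hd Y⟩
  push Not at h
  refine ⟨1, one_ne_zero, ?_⟩
  rw [mul_one, one_mul]
  have h1 := h 1
  rw [mul_one, one_mul] at h1
  have hA' : A' = A.trace • (1 : Matrix (Fin 2) (Fin 2) R) - A := by
    rw [← sub_eq_zero, ← h1]; abel
  have hcomm : ∀ Y : Matrix (Fin 2) (Fin 2) R, Y * A = A * Y := fun Y ↦ by
    have hY := h Y
    rw [hA', sub_mul, smul_mul_assoc, one_mul] at hY
    rw [← sub_eq_zero, ← hY]; abel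
  have h01 := hcomm (Matrix.single 0 1 1)
  have h10 := hcomm (Matrix.single 1 0 1)
  have e10 : A 1 0 = 0 := by
    have := congr_fun (congr_fun h01 0) 0
    simpa [Matrix.mul_apply, Fin.sum_univ_two] using this
  have e00 : A 1 1 = A 0 0 := by
    have := congr_fun (congr_fun h01 0) 1
    simpa [Matrix.mul_apply, Fin.sum_univ_two] using this
  have e01 : A 0 1 = 0 := by
    have := congr_fun (congr_fun h10 1) 1
    simpa [Matrix.mul_apply, Fin.sum_univ_two] using this
  rw [hA']
  ext i j
  fin_cases i <;> fin_cases j <;>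
    simp [Matrix.trace_fin_two, e10, e01, e00]

variable {n : Type*} [Fintype n] [DecidableEq n]

/-- If `G A = A' G` with `det G` a non-zero-divisor (e.g. `det G ≠ 0` over a domain), then
`tr A = tr A'`: multiply by `adj G` and use `tr(G A adj G) = det G · tr A`. [folklore] -/
theorem matrix_trace_eq_of_mul_eq_mul [IsDomain R] {G A A' : Matrix n n R} (h : G * A = A' * G)
    (hG : G.det ≠ 0) : A.trace = A'.trace := by
  have h1 : G * A * G.adjugate = G.det • A' := by
    rw [h, mul_assoc, Matrix.mul_adjugate, Matrix.mul_smul, mul_one]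
  have h2 : (G * A * G.adjugate).trace = G.det * A.trace := by
    rw [Matrix.trace_mul_cycle, Matrix.adjugate_mul, smul_mul_assoc, one_mul, Matrix.trace_smul,
      smul_eq_mul]
  rw [h1, Matrix.trace_smul, smul_eq_mul] at h2
  exact mul_left_cancel₀ hG h2.symm

/-- If `G A = A' G` with `det G ≠ 0` over a domain, then `det A = det A'`. [folklore] -/
theorem matrix_det_eq_of_mul_eq_mul [IsDomain R] {G A A' : Matrix n n R} (h : G * A = A' * G)
    (hG : G.det ≠ 0) : A.det = A'.det := by
  have := congrArg Matrix.det h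
  rw [Matrix.det_mul, Matrix.det_mul, mul_comm A'.det] at this
  exact mul_left_cancel₀ hG this

end Matrices

/-! ## Finite fields: every Galois automorphism is a power of Frobenius on a finite set -/

section Frobenius

variable {K : Type u} [Field K] [Finite K] {L : Type v} [Field L] [Algebra K L]

omit [Finite K] in
/-- Powers of a `q`-Frobenius: `(τ ^ m) x = x ^ (q ^ m)`. [folklore] -/
theorem algEquiv_pow_apply_of_frobenius {τ : L ≃ₐ[K] L} (hτ : ∀ x, τ x = x ^ Nat.card K) (m : ℕ)
    (x : L) : (τ ^ m) x = x ^ Nat.card K ^ m := by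
  induction m with
  | zero => simp
  | succ m ih => rw [pow_succ', AlgEquiv.mul_apply, ih, hτ, ← pow_mul, ← pow_succ]

/-- **Finite-level cyclicity of `Γ_k`.** Let `k` be finite with `q` elements, `L/k` algebraic,
`τ ∈ Aut(L/k)` the `q`-Frobenius and `σ ∈ Aut(L/k)` arbitrary. On any finite subset `S ⊆ L`,
`σ` agrees with a power of `τ`: `S` generates a finite (Galois) extension `k(S)/k`, stable under
`σ`, whose Galois group is cyclic generated by the Frobenius (Mathlib
`FiniteField.bijective_frobeniusAlgEquivOfAlgebraic_pow`). Serre, *Local Fields*, XIII.§1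
(`Gal(k̄/k) ≅ ℤ̂` topologically generated by Frobenius). [folklore] -/
theorem exists_frobenius_pow_apply_eq [Algebra.IsAlgebraic K L] (σ : L ≃ₐ[K] L) {τ : L ≃ₐ[K] L}
    (hτ : ∀ x, τ x = x ^ Nat.card K) {S : Set L} (hS : S.Finite) :
    ∃ m : ℕ, ∀ s ∈ S, σ s = (τ ^ m) s := by
  letI := Fintype.ofFinite K
  haveI : Finite S := hS.to_subtype
  let E := IntermediateField.adjoin K S
  haveI : FiniteDimensional K E :=
    IntermediateField.finiteDimensional_adjoin fun x _ ↦ Algebra.IsIntegral.isIntegral x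
  haveI : Finite E := Module.finite_of_finite K
  obtain ⟨⟨m, _hm⟩, hm⟩ :=
    (FiniteField.bijective_frobeniusAlgEquivOfAlgebraic_pow K E).2 (σ.restrictNormal E)
  refine ⟨m, fun s hs ↦ ?_⟩
  have hsE : s ∈ E := IntermediateField.subset_adjoin K S hs
  have h1 : σ s = algebraMap E L (σ.restrictNormal E ⟨s, hsE⟩) :=
    (AlgEquiv.restrictNormal_commutes σ E ⟨s, hsE⟩).symm
  rw [h1, ← hm, algEquiv_pow_apply_of_frobenius hτ]
  dsimp only
  rw [AlgEquiv.coe_pow, FiniteField.coe_frobeniusAlgEquivOfAlgebraic_iterate, map_pow,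
    Fintype.card_eq_nat_card]
  rfl

end Frobenius

end Literature.AlgebraicGeometry.Motives

/-! ## Geometric points: Galois elements agreeing on coordinates agree on points -/

namespace WeierstrassCurve

namespace geomPoints

variable {K : Type u} [Field K] {W : WeierstrassCurve K}

/-- A geometric point has a finite "field of definition": there is a finite set `S ⊆ k̄` (its
affine coordinates; empty for `O`) such that two elements of `Γ_K` agreeing on `S` agree on the
point. Silverman, *AEC*, VIII.§1 (the action on coordinates). [folklore] -/
theorem exists_finset_smul_eq (P : W.geomPoints) :
    ∃ S : Finset (AlgebraicClosure K), ∀ σ ρ : Field.absoluteGaloisGroup K,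
      (∀ s ∈ S, σ • s = ρ • s) → σ • P = ρ • P := by
  change (W.baseChange (AlgebraicClosure K)).toAffine.Point at P
  rcases P with _ | ⟨x, y, h⟩
  · refine ⟨∅, fun σ ρ _ ↦ ?_⟩
    change σ • (0 : W.geomPoints) = ρ • (0 : W.geomPoints)
    rw [smul_zero, smul_zero]
  · refine ⟨{x, y}, fun σ ρ hS ↦ ?_⟩
    have hx : σ • x = ρ • x := hS x (by simp)
    have hy : σ • y = ρ • y := hS y (by simp)
    change Affine.Point.map
        ((show AlgebraicClosure K ≃ₐ[K] AlgebraicClosure K from σ) :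
          AlgebraicClosure K →ₐ[K] AlgebraicClosure K) (.some x y h) =
      Affine.Point.map
        ((show AlgebraicClosure K ≃ₐ[K] AlgebraicClosure K from ρ) :
          AlgebraicClosure K →ₐ[K] AlgebraicClosure K) (.some x y h)
    rw [Affine.Point.map_some, Affine.Point.map_some]
    simp only [Affine.Point.some.injEq]
    exact ⟨hx, hy⟩

/-- The same for a finite set of geometric points (take the union of the coordinate sets).
[folklore] -/
theorem exists_finset_smul_eq_of_finite {Φ : Set W.geomPoints} (hΦ : Φ.Finite) :
    ∃ S : Finset (AlgebraicClosure K), ∀ σ ρ : Field.absoluteGaloisGroup K,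
      (∀ s ∈ S, σ • s = ρ • s) → ∀ P ∈ Φ, σ • P = ρ • P := by
  choose S hS using fun P : W.geomPoints ↦ exists_finset_smul_eq P
  refine ⟨hΦ.toFinset.biUnion S, fun σ ρ h P hP ↦ hS P σ ρ fun s hs ↦ h s ?_⟩
  exact Finset.mem_biUnion.mpr ⟨P, hΦ.mem_toFinset.mpr hP, hs⟩

end geomPoints

end WeierstrassCurve

/-! ## The assembly -/

namespace Literature.AlgebraicGeometry.Motives

open WeierstrassCurve

variable {K : Type u} [Field K] {W W' : WeierstrassCurve K} {ℓ : ℕ} [Fact ℓ.Prime]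

/-- The arithmetic Frobenius exists in `Γ_k` for `k` finite (Mathlib
`FiniteField.frobeniusAlgEquivOfAlgebraic`). [folklore] -/
theorem exists_frobenius (K : Type u) [Field K] [Finite K] :
    ∃ τ : Field.absoluteGaloisGroup K, ∀ x : AlgebraicClosure K, τ • x = x ^ Nat.card K := by
  letI := Fintype.ofFinite K
  refine ⟨FiniteField.frobeniusAlgEquivOfAlgebraic K (AlgebraicClosure K), fun x ↦ ?_⟩
  rw [Nat.card_eq_fintype_card]
  rfl

/-- The geometric `ℓ^n`-torsion of an elliptic curve is finite (tree:
`WeierstrassCurve.finite_torsionPoints_holds`, Silverman, *AEC*, Cor. III.6.4).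
[cite: SilvermanAEC2009, Cor. III.6.4] -/
theorem finite_geomTorsion_pow (W : WeierstrassCurve K) [W.IsElliptic] (ℓ n : ℕ) [Fact ℓ.Prime] :
    ((geomTorsion W (ℓ ^ n : ℕ) : AddSubgroup W.geomPoints) : Set W.geomPoints).Finite := by
  have hne : ((ℓ ^ n : ℕ) : ℤ) ≠ 0 := by exact_mod_cast pow_ne_zero n (Fact.out : ℓ.Prime).ne_zero
  haveI : Finite (geomTorsion W (ℓ ^ n : ℕ)) :=
    finite_torsionPoints_holds W (AlgebraicClosure K) hne
  exact Set.toFinite _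

/-- **Every `σ ∈ Γ_k` acts on `E[ℓ^n] ∪ E'[ℓ^n]` as a power of Frobenius** (the coordinates of
these finitely many points generate a finite extension of `k`, on which `σ` is a power of the
Frobenius). Silverman, *AEC*, III.§7 with V.§2; Serre, *Local Fields*, XIII.§1. [folklore] -/
theorem exists_frobenius_pow_smul_eq [Finite K] [W.IsElliptic] [W'.IsElliptic]
    {τ : Field.absoluteGaloisGroup K} (hτ : ∀ x : AlgebraicClosure K, τ • x = x ^ Nat.card K)
    (σ : Field.absoluteGaloisGroup K) (n : ℕ) :
    ∃ m : ℕ, (∀ P ∈ geomTorsion W (ℓ ^ n : ℕ), σ • P = (τ ^ m) • P) ∧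
      (∀ P ∈ geomTorsion W' (ℓ ^ n : ℕ), σ • P = (τ ^ m) • P) := by
  obtain ⟨S, hS⟩ := geomPoints.exists_finset_smul_eq_of_finite (finite_geomTorsion_pow W ℓ n)
  obtain ⟨S', hS'⟩ := geomPoints.exists_finset_smul_eq_of_finite (finite_geomTorsion_pow W' ℓ n)
  obtain ⟨m, hm⟩ := Literature.AlgebraicGeometry.Motives.exists_frobenius_pow_apply_eq (K := K) (L := AlgebraicClosure K) σ
    (τ := τ) hτ (S := ((S ∪ S' : Finset _) : Set (AlgebraicClosure K))) (Finset.finite_toSet _)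
  refine ⟨m, fun P hP ↦ hS σ (τ ^ m) (fun s hs ↦ hm s ?_) P hP,
    fun P hP ↦ hS' σ (τ ^ m) (fun s hs ↦ hm s ?_) P hP⟩
  · simp [hs]
  · simp [hs]

/-- **Frobenius-equivariant maps of Tate modules are `Γ_k`-equivariant.** A `ℤ_ℓ`-linear map
`f : T_ℓ E → T_ℓ E'` commuting with the Frobenius commutes with every `σ ∈ Γ_k`: on the `n`-th
components `σ` is a power `τ^m` of Frobenius (previous lemma), and the `n`-th component of `f x`
only depends on `x_n` (`TateModule.proj_map_eq_of_proj_eq`). This is the finite-field case of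
"`Γ_k` is topologically generated by Frobenius and the action on `T_ℓ` is continuous"
(Tate 1966, §1; Silverman, *AEC*, III.§7). [folklore] -/
theorem smul_comm_of_frobenius_comm [Finite K] [W.IsElliptic] [W'.IsElliptic]
    {τ : Field.absoluteGaloisGroup K} (hτ : ∀ x : AlgebraicClosure K, τ • x = x ^ Nat.card K)
    (f : W.tateModule ℓ →ₗ[ℤ_[ℓ]] W'.tateModule ℓ) (hf : ∀ x, f (τ • x) = τ • f x)
    (σ : Field.absoluteGaloisGroup K) (x : W.tateModule ℓ) : f (σ • x) = σ • f x := by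
  have hfm : ∀ (m : ℕ) (x : W.tateModule ℓ), f (τ ^ m • x) = τ ^ m • f x := fun m ↦ by
    induction m with
    | zero => simp
    | succ m ih => intro x; rw [pow_succ, mul_smul, mul_smul, ih, hf]
  refine Literature.NumberTheory.EllipticCurves.TateModule.ext fun n ↦ ?_
  obtain ⟨m, hW, hW'⟩ := exists_frobenius_pow_smul_eq (W := W) (W' := W') (ℓ := ℓ) hτ σ n
  have h1 : Literature.NumberTheory.EllipticCurves.TateModule.proj ℓ n (σ • x) = Literature.NumberTheory.EllipticCurves.TateModule.proj ℓ n (τ ^ m • x) := by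
    rw [Literature.NumberTheory.EllipticCurves.TateModule.proj_smul_of_distribMulAction, Literature.NumberTheory.EllipticCurves.TateModule.proj_smul_of_distribMulAction]
    exact hW _ (proj_tateModule_mem_geomTorsion W ℓ n x)
  have h2 : Literature.NumberTheory.EllipticCurves.TateModule.proj ℓ n (f (σ • x)) = Literature.NumberTheory.EllipticCurves.TateModule.proj ℓ n (f (τ ^ m • x)) :=
    Literature.NumberTheory.EllipticCurves.TateModule.proj_map_eq_of_proj_eq f.toAddMonoidHom h1
  rw [h2, hfm, Literature.NumberTheory.EllipticCurves.TateModule.proj_smul_of_distribMulAction, Literature.NumberTheory.EllipticCurves.TateModule.proj_smul_of_distribMulAction]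
  exact (hW' _ (proj_tateModule_mem_geomTorsion W' ℓ n (f x))).symm

/-- An injective linear map between free modules with bases indexed by the same finite type has a
matrix with non-zero determinant (over a domain: a matrix with determinant `0` kills a non-zero
vector, Mathlib `Matrix.exists_mulVec_eq_zero_iff`). [folklore] -/
theorem det_toMatrix_ne_zero_of_injective {R : Type v} [CommRing R] [IsDomain R] {M M' : Type u}
    [AddCommGroup M] [Module R M] [AddCommGroup M'] [Module R M'] {ι : Type} [Fintype ι]
    [DecidableEq ι] (b : Module.Basis ι R M) (b' : Module.Basis ι R M') (g : M →ₗ[R] M')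
    (hg : Function.Injective g) : (LinearMap.toMatrix b b' g).det ≠ 0 := by
  intro h0
  obtain ⟨v, hv, hGv⟩ := Matrix.exists_mulVec_eq_zero_iff.mpr h0
  apply hv
  set x := b.equivFun.symm v with hx
  have hbx : ⇑(b.repr x) = v := by rw [← Module.Basis.equivFun_apply, hx, LinearEquiv.apply_symm_apply]
  have h1 := LinearMap.toMatrix_mulVec_repr b b' g x
  rw [hbx, hGv] at h1
  have hgx : g x = 0 := by
    rw [← b'.repr.map_eq_zero_iff]
    exact Finsupp.ext fun i ↦ (congr_fun h1 i).symm
  have hx0 : x = 0 := hg (hgx.trans (map_zero g).symm)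
  rw [← hbx, hx0, map_zero]
  rfl

/-- **Isogenous elliptic curves over a finite field have the same number of points** (Silverman,
*AEC*, Exercise 5.4(a); Tate 1966, Thm. 1), *from* the trace-of-Frobenius statements `htr`,
`htr'` for `E` and `E'` at one prime `ℓ ≠ char k` (the bodies of the named fact
`WeierstrassCurve.trace_galoisRepTate_frobenius` of
`Literature.NumberTheory.EllipticCurves.FrobeniusTateModule`, Silverman Thm. V.2.3.1). Proof: for
an isogeny `φ`, `T_ℓ φ : T_ℓ E → T_ℓ E'` is injective (finite kernel) and Frobenius-equivariant;
in bases of the two rank-`2` lattices its matrix `G` has `det G ≠ 0` and `G A = A' G` for the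
matrices `A, A'` of Frobenius, whence `tr A = tr A'`, i.e. `q + 1 - #E(k) = q + 1 - #E'(k)`.
[cite: SilvermanAEC2009, Exercise 5.4(a) with Thm. V.2.3.1] -/
theorem card_point_eq_of_isIsogenous_of
    (htr : ∀ [Finite K] [W.IsElliptic], (ℓ : K) ≠ 0 → ∀ σ : Field.absoluteGaloisGroup K,
      (∀ x : AlgebraicClosure K, σ • x = x ^ Nat.card K) →
        LinearMap.trace ℤ_[ℓ] (W.tateModule ℓ) (W.galoisRepTate ℓ σ) =
          (Nat.card K : ℤ_[ℓ]) + 1 - (Nat.card W.toAffine.Point : ℤ_[ℓ]))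
    (htr' : ∀ [Finite K] [W'.IsElliptic], (ℓ : K) ≠ 0 → ∀ σ : Field.absoluteGaloisGroup K,
      (∀ x : AlgebraicClosure K, σ • x = x ^ Nat.card K) →
        LinearMap.trace ℤ_[ℓ] (W'.tateModule ℓ) (W'.galoisRepTate ℓ σ) =
          (Nat.card K : ℤ_[ℓ]) + 1 - (Nat.card W'.toAffine.Point : ℤ_[ℓ]))
    [Finite K] [W.IsElliptic] [W'.IsElliptic] (hℓ : (ℓ : K) ≠ 0) (h : W.IsIsogenous W') :
    Nat.card W.toAffine.Point = Nat.card W'.toAffine.Point := by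
  obtain ⟨φ⟩ := h
  obtain ⟨τ, hτ⟩ := exists_frobenius K
  haveI := module_free_tateModule_holds W ℓ
  haveI := module_finite_tateModule_holds W ℓ
  haveI := module_free_tateModule_holds W' ℓ
  haveI := module_finite_tateModule_holds W' ℓ
  let b := Module.finBasisOfFinrankEq ℤ_[ℓ] (W.tateModule ℓ) (finrank_tateModule_eq_two_holds W ℓ hℓ)
  let b' :=
    Module.finBasisOfFinrankEq ℤ_[ℓ] (W'.tateModule ℓ) (finrank_tateModule_eq_two_holds W' ℓ hℓ)
  let g : W.tateModule ℓ →ₗ[ℤ_[ℓ]] W'.tateModule ℓ := Literature.NumberTheory.EllipticCurves.TateModule.map ℓ φ.toAddMonoidHom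
  have hg : Function.Injective g := tateModule_map_injective ℓ φ
  have hcomm : g ∘ₗ W.galoisRepTate ℓ τ = W'.galoisRepTate ℓ τ ∘ₗ g :=
    LinearMap.ext fun x ↦ tateModule_map_smul ℓ φ τ x
  have hGA : LinearMap.toMatrix b b' g * LinearMap.toMatrix b b (W.galoisRepTate ℓ τ) =
      LinearMap.toMatrix b' b' (W'.galoisRepTate ℓ τ) * LinearMap.toMatrix b b' g := by
    rw [← LinearMap.toMatrix_comp b b b', hcomm, LinearMap.toMatrix_comp b b' b']
  have htrace := matrix_trace_eq_of_mul_eq_mul hGA (det_toMatrix_ne_zero_of_injective b b' g hg)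
  rw [← LinearMap.trace_eq_matrix_trace ℤ_[ℓ] b, ← LinearMap.trace_eq_matrix_trace ℤ_[ℓ] b',
    htr hℓ τ hτ, htr' hℓ τ hτ, sub_right_inj] at htrace
  exact Nat.cast_injective htrace

/-- **Elliptic curves over a finite field with the same number of points are isogenous**
(Silverman, *AEC*, Exercise 5.4(b); Tate 1966, Thm. 1), *from*: Tate's theorem in Tate-module
form `hT` (the named fact `isIsogenous_of_finite_iff_exists_tateModule_hom_ne_zero W W' ℓ` of
`FaltingsEC`; only its direction `←` is used) and the trace and determinant of Frobenius on
`T_ℓ E`, `T_ℓ E'` (`htr, hdet, htr', hdet'`: the bodies of the named facts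
`trace_galoisRepTate_frobenius`, `det_galoisRepTate_frobenius` of `FrobeniusTateModule`,
Silverman Thm. V.2.3.1), at one prime `ℓ ≠ char k`. Proof: equal point counts give Frobenius
matrices `A, A'` (in bases of the rank-`2` lattices `T_ℓ E`, `T_ℓ E'`) with the same trace and
determinant, hence a non-zero `X` with `A' X = X A` (`exists_ne_zero_matrix_fin_two_intertwiner`);
the corresponding `f : T_ℓ E → T_ℓ E'` is non-zero and Frobenius-equivariant, hence
`Γ_k`-equivariant (`smul_comm_of_frobenius_comm`), and Tate's theorem gives an isogeny.
[cite: SilvermanAEC2009, Exercise 5.4(b) with Thm. III.7.7(a)] -/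
theorem isIsogenous_of_card_point_eq_of
    (hT : isIsogenous_of_finite_iff_exists_tateModule_hom_ne_zero W W' ℓ)
    (htr : ∀ [Finite K] [W.IsElliptic], (ℓ : K) ≠ 0 → ∀ σ : Field.absoluteGaloisGroup K,
      (∀ x : AlgebraicClosure K, σ • x = x ^ Nat.card K) →
        LinearMap.trace ℤ_[ℓ] (W.tateModule ℓ) (W.galoisRepTate ℓ σ) =
          (Nat.card K : ℤ_[ℓ]) + 1 - (Nat.card W.toAffine.Point : ℤ_[ℓ]))
    (hdet : ∀ [Finite K] [W.IsElliptic], (ℓ : K) ≠ 0 → ∀ σ : Field.absoluteGaloisGroup K,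
      (∀ x : AlgebraicClosure K, σ • x = x ^ Nat.card K) →
        LinearMap.det (W.galoisRepTate ℓ σ : W.tateModule ℓ →ₗ[ℤ_[ℓ]] W.tateModule ℓ) =
          (Nat.card K : ℤ_[ℓ]))
    (htr' : ∀ [Finite K] [W'.IsElliptic], (ℓ : K) ≠ 0 → ∀ σ : Field.absoluteGaloisGroup K,
      (∀ x : AlgebraicClosure K, σ • x = x ^ Nat.card K) →
        LinearMap.trace ℤ_[ℓ] (W'.tateModule ℓ) (W'.galoisRepTate ℓ σ) =
          (Nat.card K : ℤ_[ℓ]) + 1 - (Nat.card W'.toAffine.Point : ℤ_[ℓ]))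
    (hdet' : ∀ [Finite K] [W'.IsElliptic], (ℓ : K) ≠ 0 → ∀ σ : Field.absoluteGaloisGroup K,
      (∀ x : AlgebraicClosure K, σ • x = x ^ Nat.card K) →
        LinearMap.det (W'.galoisRepTate ℓ σ : W'.tateModule ℓ →ₗ[ℤ_[ℓ]] W'.tateModule ℓ) =
          (Nat.card K : ℤ_[ℓ]))
    [Finite K] [W.IsElliptic] [W'.IsElliptic] (hℓ : (ℓ : K) ≠ 0)
    (h : Nat.card W.toAffine.Point = Nat.card W'.toAffine.Point) : W.IsIsogenous W' := by
  obtain ⟨τ, hτ⟩ := exists_frobenius K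
  haveI := module_free_tateModule_holds W ℓ
  haveI := module_finite_tateModule_holds W ℓ
  haveI := module_free_tateModule_holds W' ℓ
  haveI := module_finite_tateModule_holds W' ℓ
  let b := Module.finBasisOfFinrankEq ℤ_[ℓ] (W.tateModule ℓ) (finrank_tateModule_eq_two_holds W ℓ hℓ)
  let b' :=
    Module.finBasisOfFinrankEq ℤ_[ℓ] (W'.tateModule ℓ) (finrank_tateModule_eq_two_holds W' ℓ hℓ)
  -- the Frobenius matrices have the same trace and determinant
  have ht : (LinearMap.toMatrix b' b' (W'.galoisRepTate ℓ τ)).trace =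
      (LinearMap.toMatrix b b (W.galoisRepTate ℓ τ)).trace := by
    rw [← LinearMap.trace_eq_matrix_trace ℤ_[ℓ] b, ← LinearMap.trace_eq_matrix_trace ℤ_[ℓ] b',
      htr hℓ τ hτ, htr' hℓ τ hτ, h]
  have hd : (LinearMap.toMatrix b' b' (W'.galoisRepTate ℓ τ)).det =
      (LinearMap.toMatrix b b (W.galoisRepTate ℓ τ)).det := by
    rw [LinearMap.det_toMatrix, LinearMap.det_toMatrix, hdet hℓ τ hτ, hdet' hℓ τ hτ]
  obtain ⟨X, hX0, hX⟩ := exists_ne_zero_matrix_fin_two_intertwiner ht hd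
  let f : W.tateModule ℓ →ₗ[ℤ_[ℓ]] W'.tateModule ℓ := Matrix.toLin b b' X
  have hf0 : f ≠ 0 := fun h0 ↦ hX0 ((Matrix.toLin b b').map_eq_zero_iff.mp h0)
  have hcomm : W'.galoisRepTate ℓ τ ∘ₗ f = f ∘ₗ W.galoisRepTate ℓ τ := by
    have h1 := congrArg (Matrix.toLin b b') hX
    rw [Matrix.toLin_mul b b' b', Matrix.toLin_mul b b b', Matrix.toLin_toMatrix,
      Matrix.toLin_toMatrix] at h1
    exact h1
  have hf : ∀ x, f (τ • x) = τ • f x := fun x ↦ by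
    have := LinearMap.congr_fun hcomm x
    simpa only [LinearMap.comp_apply, galoisRepTate_apply_apply] using this.symm
  exact (hT hℓ).mpr ⟨f, hf0, smul_comm_of_frobenius_comm hτ f hf⟩

/-- There is a prime `ℓ ∈ {2, 3}` invertible in any field `K`. [folklore] -/
theorem exists_prime_natCast_ne_zero (K : Type u) [Field K] :
    ∃ ℓ : ℕ, ℓ.Prime ∧ (ℓ : K) ≠ 0 := by
  by_cases h2 : ((2 : ℕ) : K) = 0
  · refine ⟨3, Nat.prime_three, fun h3 ↦ one_ne_zero (α := K) ?_⟩
    have : ((3 : ℕ) : K) - ((2 : ℕ) : K) = 1 := by push_cast; ring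
    rw [← this, h2, h3, sub_zero]
  · exact ⟨2, Nat.prime_two, h2⟩

/-- **Tate's isogeny theorem in point-count form, from the named facts at one prime `ℓ ≠ char k`**:
the named fact `isIsogenous_iff_card_point_eq W W'` (`FaltingsEC`; Tate 1966, Thm. 1; Silverman,
*AEC*, Exercise 5.4) follows from Tate's theorem in Tate-module form (`hT`, the named fact
`isIsogenous_of_finite_iff_exists_tateModule_hom_ne_zero W W' ℓ` of `FaltingsEC`) and the trace
and determinant of Frobenius on `T_ℓ E`, `T_ℓ E'` (`htr, hdet, htr', hdet'`: the bodies of the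
named facts `trace_galoisRepTate_frobenius`, `det_galoisRepTate_frobenius` of
`Literature.NumberTheory.EllipticCurves.FrobeniusTateModule`; Silverman, *AEC*, Thm. V.2.3.1),
by `card_point_eq_of_isIsogenous_of` and `isIsogenous_of_card_point_eq_of`.
[cite: Tate1966Endomorphisms, Thm. 1] [cite: SilvermanAEC2009, Exercise 5.4] -/
theorem isIsogenous_iff_card_point_eq_of (hℓ : (ℓ : K) ≠ 0)
    (hT : isIsogenous_of_finite_iff_exists_tateModule_hom_ne_zero W W' ℓ)
    (htr : ∀ [Finite K] [W.IsElliptic], (ℓ : K) ≠ 0 → ∀ σ : Field.absoluteGaloisGroup K,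
      (∀ x : AlgebraicClosure K, σ • x = x ^ Nat.card K) →
        LinearMap.trace ℤ_[ℓ] (W.tateModule ℓ) (W.galoisRepTate ℓ σ) =
          (Nat.card K : ℤ_[ℓ]) + 1 - (Nat.card W.toAffine.Point : ℤ_[ℓ]))
    (hdet : ∀ [Finite K] [W.IsElliptic], (ℓ : K) ≠ 0 → ∀ σ : Field.absoluteGaloisGroup K,
      (∀ x : AlgebraicClosure K, σ • x = x ^ Nat.card K) →
        LinearMap.det (W.galoisRepTate ℓ σ : W.tateModule ℓ →ₗ[ℤ_[ℓ]] W.tateModule ℓ) =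
          (Nat.card K : ℤ_[ℓ]))
    (htr' : ∀ [Finite K] [W'.IsElliptic], (ℓ : K) ≠ 0 → ∀ σ : Field.absoluteGaloisGroup K,
      (∀ x : AlgebraicClosure K, σ • x = x ^ Nat.card K) →
        LinearMap.trace ℤ_[ℓ] (W'.tateModule ℓ) (W'.galoisRepTate ℓ σ) =
          (Nat.card K : ℤ_[ℓ]) + 1 - (Nat.card W'.toAffine.Point : ℤ_[ℓ]))
    (hdet' : ∀ [Finite K] [W'.IsElliptic], (ℓ : K) ≠ 0 → ∀ σ : Field.absoluteGaloisGroup K,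
      (∀ x : AlgebraicClosure K, σ • x = x ^ Nat.card K) →
        LinearMap.det (W'.galoisRepTate ℓ σ : W'.tateModule ℓ →ₗ[ℤ_[ℓ]] W'.tateModule ℓ) =
          (Nat.card K : ℤ_[ℓ])) :
    isIsogenous_iff_card_point_eq W W' := by
  intro _ _ _
  exact ⟨card_point_eq_of_isIsogenous_of htr htr' hℓ,
    isIsogenous_of_card_point_eq_of hT htr hdet htr' hdet' hℓ⟩

/-- **Tate's isogeny theorem in point-count form, from Tate's Main Theorem and the trace and
determinant of Frobenius at one prime `ℓ ≠ char k`**: as `isIsogenous_iff_card_point_eq_of`, with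
Tate's theorem entering through the root named fact
`mem_span_range_tateModule_map_of_equivariant_of_finite W W' ℓ` (`FaltingsEC`; surjectivity of
`Hom_k(E, E') ⊗ ℤ_ℓ → Hom_{Γ_k}(T_ℓ E, T_ℓ E')`, Tate 1966, Main Theorem), via the tree's
deduction `isIsogenous_iff_exists_tateModule_hom_ne_zero_of_finite_of_tate`
(`FaltingsECIsogenyProofs`) of the corrected Tate-module fact from it.
[cite: Tate1966Endomorphisms, Main Theorem and Thm. 1] [cite: SilvermanAEC2009, Exercise 5.4] -/
theorem isIsogenous_iff_card_point_eq_of_tate (hℓ : (ℓ : K) ≠ 0)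
    (hT : mem_span_range_tateModule_map_of_equivariant_of_finite W W' ℓ)
    (htr : ∀ [Finite K] [W.IsElliptic], (ℓ : K) ≠ 0 → ∀ σ : Field.absoluteGaloisGroup K,
      (∀ x : AlgebraicClosure K, σ • x = x ^ Nat.card K) →
        LinearMap.trace ℤ_[ℓ] (W.tateModule ℓ) (W.galoisRepTate ℓ σ) =
          (Nat.card K : ℤ_[ℓ]) + 1 - (Nat.card W.toAffine.Point : ℤ_[ℓ]))
    (hdet : ∀ [Finite K] [W.IsElliptic], (ℓ : K) ≠ 0 → ∀ σ : Field.absoluteGaloisGroup K,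
      (∀ x : AlgebraicClosure K, σ • x = x ^ Nat.card K) →
        LinearMap.det (W.galoisRepTate ℓ σ : W.tateModule ℓ →ₗ[ℤ_[ℓ]] W.tateModule ℓ) =
          (Nat.card K : ℤ_[ℓ]))
    (htr' : ∀ [Finite K] [W'.IsElliptic], (ℓ : K) ≠ 0 → ∀ σ : Field.absoluteGaloisGroup K,
      (∀ x : AlgebraicClosure K, σ • x = x ^ Nat.card K) →
        LinearMap.trace ℤ_[ℓ] (W'.tateModule ℓ) (W'.galoisRepTate ℓ σ) =
          (Nat.card K : ℤ_[ℓ]) + 1 - (Nat.card W'.toAffine.Point : ℤ_[ℓ]))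
    (hdet' : ∀ [Finite K] [W'.IsElliptic], (ℓ : K) ≠ 0 → ∀ σ : Field.absoluteGaloisGroup K,
      (∀ x : AlgebraicClosure K, σ • x = x ^ Nat.card K) →
        LinearMap.det (W'.galoisRepTate ℓ σ : W'.tateModule ℓ →ₗ[ℤ_[ℓ]] W'.tateModule ℓ) =
          (Nat.card K : ℤ_[ℓ])) :
    isIsogenous_iff_card_point_eq W W' :=
  isIsogenous_iff_card_point_eq_of hℓ
    (fun hℓ' ↦ isIsogenous_iff_exists_tateModule_hom_ne_zero_of_finite_of_tate W W' ℓ hℓ' hT)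
    htr hdet htr' hdet'

/-- **Tate's isogeny theorem in point-count form, from the named facts at all primes**: the form
in which `isIsogenous_iff_card_point_eq_holds` will be assembled once the named facts are
discharged (a prime `ℓ ∈ {2, 3}` with `ℓ ≠ char k` always exists, `exists_prime_natCast_ne_zero`).
[cite: Tate1966Endomorphisms, Thm. 1] [cite: SilvermanAEC2009, Exercise 5.4] -/
theorem isIsogenous_iff_card_point_eq_of_forall
    (hT : ∀ (ℓ : ℕ) [Fact ℓ.Prime], isIsogenous_of_finite_iff_exists_tateModule_hom_ne_zero W W' ℓ)
    (htr : ∀ (ℓ : ℕ) [Fact ℓ.Prime], ∀ [Finite K] [W.IsElliptic], (ℓ : K) ≠ 0 →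
      ∀ σ : Field.absoluteGaloisGroup K, (∀ x : AlgebraicClosure K, σ • x = x ^ Nat.card K) →
        LinearMap.trace ℤ_[ℓ] (W.tateModule ℓ) (W.galoisRepTate ℓ σ) =
          (Nat.card K : ℤ_[ℓ]) + 1 - (Nat.card W.toAffine.Point : ℤ_[ℓ]))
    (hdet : ∀ (ℓ : ℕ) [Fact ℓ.Prime], ∀ [Finite K] [W.IsElliptic], (ℓ : K) ≠ 0 →
      ∀ σ : Field.absoluteGaloisGroup K, (∀ x : AlgebraicClosure K, σ • x = x ^ Nat.card K) →
        LinearMap.det (W.galoisRepTate ℓ σ : W.tateModule ℓ →ₗ[ℤ_[ℓ]] W.tateModule ℓ) =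
          (Nat.card K : ℤ_[ℓ]))
    (htr' : ∀ (ℓ : ℕ) [Fact ℓ.Prime], ∀ [Finite K] [W'.IsElliptic], (ℓ : K) ≠ 0 →
      ∀ σ : Field.absoluteGaloisGroup K, (∀ x : AlgebraicClosure K, σ • x = x ^ Nat.card K) →
        LinearMap.trace ℤ_[ℓ] (W'.tateModule ℓ) (W'.galoisRepTate ℓ σ) =
          (Nat.card K : ℤ_[ℓ]) + 1 - (Nat.card W'.toAffine.Point : ℤ_[ℓ]))
    (hdet' : ∀ (ℓ : ℕ) [Fact ℓ.Prime], ∀ [Finite K] [W'.IsElliptic], (ℓ : K) ≠ 0 →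
      ∀ σ : Field.absoluteGaloisGroup K, (∀ x : AlgebraicClosure K, σ • x = x ^ Nat.card K) →
        LinearMap.det (W'.galoisRepTate ℓ σ : W'.tateModule ℓ →ₗ[ℤ_[ℓ]] W'.tateModule ℓ) =
          (Nat.card K : ℤ_[ℓ])) :
    isIsogenous_iff_card_point_eq W W' := by
  intro _ _ _
  obtain ⟨l, hl, hlK⟩ := exists_prime_natCast_ne_zero K
  haveI : Fact l.Prime := ⟨hl⟩
  exact isIsogenous_iff_card_point_eq_of hlK (hT l) (@htr l _) (@hdet l _) (@htr' l _) (@hdet' l _)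

end Literature.AlgebraicGeometry.Motives
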